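import Summits.NavierStokesRegularity.NavierStokesRegularity.Theorems.LevelSetModerationHighSpeedPressureWorkSliceMeasurability
import Summits.NavierStokesRegularity.NavierStokesRegularity.Theorems.LevelSetModerationHighSpeedPressureWorkTimeCauchySchwarz
import Summits.NavierStokesRegularity.NavierStokesRegularity.Theorems.LevelSetModerationHighSpeedPressureWorkConsequences

/-!
# Route LevelSetModeration — `HighSpeedPressureWork`: the Galilean-cost Cauchy–Schwarz

Support file for item stmt-NavierStokesRegularity-18149; proves the registered stub
`stub_costCauchySchwarz` of line `Sketch`: for a classical solution on `ℝ³ × [0,T)` that is Leray–Hopf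
on `[0,T]`, a level `c > 0` and `t ∈ [0,T)`,

  `∫₀ᵗ∫ 1_{|u|>c} ‖D|u|‖ ≤ √(V_c(T)) · √(D_c(T))`,

`V_c(T) = ∫₀ᵀ |{|u(τ)|>c}|`, `D_c(T) = ∫₀ᵀ∫ 1_{|u|>c}‖D|u|‖²` (as `toReal` of lower Lebesgue integrals).
Slice by slice: `|{|u(τ)|>c}| ≤ ‖u(τ)‖₂²/c² < ∞` (Chebyshev, Leray–Hopf energy bound) and, for a.e. `τ`,
the dissipation slice is finite, so `∫ 1_A ‖D|u|‖ ≤ √|A| √(∫ 1_A ‖D|u|‖²)` (Hölder, or `0 ≤ …` when the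
slice is not integrable); then Cauchy–Schwarz in time (`levelSetModeration_setIntegral_le_sqrt_mul_sqrt`)
with the measurability of the slices (`levelSetModeration_aemeasurable_dissipationSlice`, sections of
the measurable set `{c < |u|} ∩ slab`) and the finiteness of `V_c(T)`, `D_c(T)`
(`levelSetDissipation_ne_top`).
-/

noncomputable section

-- single-conjunct summit: `Summit.<Summit>.<Problem>` repeats the name by the D-0017 layout
set_option linter.dupNamespace false

namespace Summit.NavierStokesRegularity.NavierStokesRegularity.Theorems

open MeasureTheory Set Filter Topology Function
open scoped ENNReal
open Literature.Analysis.FluidPDE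

/-- **Chebyshev on a slice of a Leray–Hopf solution**: for `τ ∈ [0, T]`, `c > 0` and `ν ≥ 0`,
`|{x | c < ‖u τ x‖}| ≤ ofReal (2 E(u₀)) / ofReal c²` — in particular finite. [folklore] -/
theorem levelSetModeration_volume_superlevel_le {T ν : ℝ} (hν : 0 ≤ ν)
    {u : ℝ → EuclideanSpace ℝ (Fin 3) → EuclideanSpace ℝ (Fin 3)}
    (hLH : IsLerayHopfOn T ν 0 (u 0) u) {τ : ℝ} (hτ : τ ∈ Icc 0 T) {c : ℝ} (hc : 0 < c) :
    volume {x | c < ‖u τ x‖} ≤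
      ENNReal.ofReal (2 * VectorCalculus.kineticEnergy (u 0)) / ENNReal.ofReal (c ^ 2) := by
  have hmeas : AEMeasurable (fun x => ‖u τ x‖ₑ ^ 2) volume :=
    ((hLH.memLp τ hτ).aestronglyMeasurable.enorm.pow_const 2)
  have hsub : {x | c < ‖u τ x‖} ⊆ {x | ENNReal.ofReal (c ^ 2) ≤ ‖u τ x‖ₑ ^ 2} := by
    intro x hx
    have hx' : c < ‖u τ x‖ := hx
    show ENNReal.ofReal (c ^ 2) ≤ ‖u τ x‖ₑ ^ 2
    rw [← ofReal_norm, ← ENNReal.ofReal_pow (norm_nonneg _)]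
    exact ENNReal.ofReal_le_ofReal (pow_le_pow_left₀ hc.le hx'.le 2)
  calc volume {x | c < ‖u τ x‖} ≤ volume {x | ENNReal.ofReal (c ^ 2) ≤ ‖u τ x‖ₑ ^ 2} :=
        measure_mono hsub
    _ ≤ (∫⁻ x, ‖u τ x‖ₑ ^ 2) / ENNReal.ofReal (c ^ 2) :=
        meas_ge_le_lintegral_div hmeas (by positivity) ENNReal.ofReal_ne_top
    _ ≤ ENNReal.ofReal (2 * VectorCalculus.kineticEnergy (u 0)) / ENNReal.ofReal (c ^ 2) := by
        gcongr
        exact hLH.lintegral_enorm_sq_le hν hτ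

/-- **The space–time measure of the high-speed set is finite**: `∫⁻_{(0,T)} |{|u(τ)|>c}| < ∞` for a
Leray–Hopf solution (`ν ≥ 0`, `c > 0`). [folklore] -/
theorem levelSetModeration_highSetMeasure_ne_top {T ν : ℝ} (hν : 0 ≤ ν)
    {u : ℝ → EuclideanSpace ℝ (Fin 3) → EuclideanSpace ℝ (Fin 3)}
    (hLH : IsLerayHopfOn T ν 0 (u 0) u) {c : ℝ} (hc : 0 < c) :
    (∫⁻ τ in Ioo 0 T, volume {x | c < ‖u τ x‖}) ≠ ∞ := by
  set K : ℝ≥0∞ := ENNReal.ofReal (2 * VectorCalculus.kineticEnergy (u 0)) / ENNReal.ofReal (c ^ 2)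
  have hK : K ≠ ∞ := ENNReal.div_ne_top ENNReal.ofReal_ne_top
    ((ENNReal.ofReal_pos.2 (by positivity)).ne')
  have h1 : (∫⁻ τ in Ioo 0 T, volume {x | c < ‖u τ x‖}) ≤ ∫⁻ _ in Ioo 0 T, K := by
    refine lintegral_mono_ae ?_
    filter_upwards [ae_restrict_mem measurableSet_Ioo] with τ hτ
    exact levelSetModeration_volume_superlevel_le hν hLH ⟨hτ.1.le, hτ.2.le⟩ hc
  refine ne_top_of_le_ne_top ?_ h1
  rw [setLIntegral_const]
  exact ENNReal.mul_ne_top hK (measure_Ioo_lt_top.ne)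

/-- **Time-measurability of the slice measure of the high-speed set**: for `u` jointly continuous on
`[0,T) × ℝ³` and `t ≤ T`, `τ ↦ |{x | c < ‖u τ x‖}|` is a.e.-measurable on `(0, t)` (sections of the
measurable set `{c < |u|} ∩ slab`). [folklore] -/
theorem levelSetModeration_aemeasurable_volume_superlevel {T : ℝ}
    {u : ℝ → EuclideanSpace ℝ (Fin 3) → EuclideanSpace ℝ (Fin 3)}
    (hu : ContinuousOn (uncurry u) (Ico 0 T ×ˢ univ)) (c : ℝ) {t : ℝ} (ht : t ≤ T) :
    AEMeasurable (fun τ => volume {x | c < ‖u τ x‖}) (volume.restrict (Ioo 0 t)) := by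
  set W : Set (ℝ × EuclideanSpace ℝ (Fin 3)) :=
    {z | z ∈ Ico 0 T ×ˢ univ ∧ c < ‖uncurry u z‖} with hW
  have hWmeas : MeasurableSet W := levelSetModeration_measurableSet_superlevel_slab hu c
  have hm : Measurable fun τ => (volume : Measure (EuclideanSpace ℝ (Fin 3))) (Prod.mk τ ⁻¹' W) :=
    measurable_measure_prodMk_left hWmeas
  refine hm.aemeasurable.congr ?_
  filter_upwards [ae_restrict_mem measurableSet_Ioo] with τ hτ
  have hτ' : τ ∈ Ico 0 T := ⟨hτ.1.le, hτ.2.trans_le ht⟩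
  congr 1
  ext x
  simp only [mem_preimage, hW, mem_setOf_eq, mem_prod, mem_univ, and_true, uncurry_apply_pair]
  exact ⟨fun h => h.2, fun h => ⟨hτ', h⟩⟩

/-- **Cauchy–Schwarz on one slice**: for a continuous slice `w` with `|{c < |w|}| < ∞` and finite
level-set dissipation, `∫ 1_A ‖D|w|‖ ≤ √|A| · √(∫⁻ 1_A ofReal ‖D|w|‖²)` (Hölder `2,2` against the
indicator; if the slice is not integrable its Bochner integral is `0`). [folklore] -/
theorem levelSetModeration_integral_indicator_norm_fderiv_le
    {w : EuclideanSpace ℝ (Fin 3) → EuclideanSpace ℝ (Fin 3)} (hw : Continuous w) {c : ℝ}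
    (hV : volume {x | c < ‖w x‖} ≠ ∞)
    (hD : (∫⁻ x, {x | c < ‖w x‖}.indicator
      (fun x => ENNReal.ofReal (‖fderiv ℝ (fun y => ‖w y‖) x‖ ^ 2)) x) ≠ ∞) :
    (∫ x, {x | c < ‖w x‖}.indicator (fun x => ‖fderiv ℝ (fun y => ‖w y‖) x‖) x) ≤
      Real.sqrt (volume {x | c < ‖w x‖}).toReal *
        Real.sqrt (∫⁻ x, {x | c < ‖w x‖}.indicator
          (fun x => ENNReal.ofReal (‖fderiv ℝ (fun y => ‖w y‖) x‖ ^ 2)) x).toReal := by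
  set A : Set (EuclideanSpace ℝ (Fin 3)) := {x | c < ‖w x‖} with hA
  set g : EuclideanSpace ℝ (Fin 3) → ℝ := A.indicator fun x => ‖fderiv ℝ (fun y => ‖w y‖) x‖ with hg
  have hA_meas : MeasurableSet A := (isOpen_lt continuous_const hw.norm).measurableSet
  have hg0 : ∀ x, 0 ≤ g x := fun x => indicator_nonneg (fun y _ => norm_nonneg _) x
  by_cases hgi : Integrable g volume
  · -- Hölder against the indicator of `A`
    set f : EuclideanSpace ℝ (Fin 3) → ℝ := A.indicator fun _ => (1 : ℝ) with hf
    have hf0 : ∀ x, 0 ≤ f x := fun x => indicator_nonneg (fun _ _ => zero_le_one) x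
    have hfg : ∀ x, f x * g x = g x := fun x => by
      by_cases hx : x ∈ A
      · simp [hf, hg, indicator_of_mem hx]
      · simp [hf, hg, indicator_of_notMem hx]
    have hfL2 : MemLp f (ENNReal.ofReal 2) volume := by
      rw [ENNReal.ofReal_ofNat]
      exact memLp_indicator_const 2 hA_meas (1 : ℝ) (Or.inr hV)
    have hlin : ∀ x, ENNReal.ofReal (g x ^ 2) = A.indicator
        (fun x => ENNReal.ofReal (‖fderiv ℝ (fun y => ‖w y‖) x‖ ^ 2)) x := by
      intro x
      by_cases hx : x ∈ A
      · simp [hg, indicator_of_mem hx]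
      · simp [hg, indicator_of_notMem hx]
    have hg2_int : Integrable (fun x => g x ^ 2) volume := by
      have hmeas : AEStronglyMeasurable (fun x => g x ^ 2) volume :=
        (hgi.aestronglyMeasurable.aemeasurable.pow_const 2).aestronglyMeasurable
      refine ⟨hmeas, ?_⟩
      rw [hasFiniteIntegral_iff_enorm]
      have : ∀ x, ‖g x ^ 2‖ₑ = ENNReal.ofReal (g x ^ 2) := fun x => by
        rw [Real.enorm_eq_ofReal (sq_nonneg _)]
      simp_rw [this, hlin]
      exact lt_top_iff_ne_top.2 hD
    have hgL2 : MemLp g (ENNReal.ofReal 2) volume := by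
      rw [ENNReal.ofReal_ofNat, memLp_two_iff_integrable_sq hgi.aestronglyMeasurable]
      exact hg2_int
    have hH := integral_mul_le_Lp_mul_Lq_of_nonneg (μ := volume) Real.HolderConjugate.two_two
      (Eventually.of_forall hf0) (Eventually.of_forall hg0) hfL2 hgL2
    simp_rw [hfg] at hH
    refine hH.trans (le_of_eq ?_)
    have hIf : (∫ x, f x ^ (2 : ℝ)) = (volume A).toReal := by
      have : (fun x => f x ^ (2 : ℝ)) = A.indicator fun _ => (1 : ℝ) := by
        funext x
        by_cases hx : x ∈ A
        · simp [hf, indicator_of_mem hx]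
        · simp [hf, indicator_of_notMem hx]
      rw [this, integral_indicator hA_meas, setIntegral_const, smul_eq_mul, mul_one]
      rfl
    have hIg : (∫ x, g x ^ (2 : ℝ)) = (∫⁻ x, A.indicator
        (fun x => ENNReal.ofReal (‖fderiv ℝ (fun y => ‖w y‖) x‖ ^ 2)) x).toReal := by
      have h2 : (∫ x, g x ^ (2 : ℝ)) = ∫ x, g x ^ 2 :=
        integral_congr_ae (Eventually.of_forall fun x => Real.rpow_two _)
      rw [h2, integral_eq_lintegral_of_nonneg_ae (Eventually.of_forall fun x => sq_nonneg _)
        hg2_int.aestronglyMeasurable]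
      congr 1
      exact lintegral_congr fun x => hlin x
    rw [hIf, hIg, ← Real.sqrt_eq_rpow, ← Real.sqrt_eq_rpow]
  · rw [integral_undef hgi]
    exact mul_nonneg (Real.sqrt_nonneg _) (Real.sqrt_nonneg _)

/-- **The Galilean-cost Cauchy–Schwarz** (registered stub `stub_costCauchySchwarz` of the crux item
stmt-NavierStokesRegularity-18149, line `Sketch`): for a classical solution of the unforced
Navier–Stokes system on `ℝ³ × [0,T)` (`ν, T > 0`) that is Leray–Hopf on `[0,T]`, `c > 0`, `t ∈ [0,T)`:
`∫₀ᵗ∫ 1_{|u|>c} ‖D|u|‖ ≤ √(V_c(T)) · √(D_c(T))`. [folklore] -/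
theorem stub_costCauchySchwarz :
    ∀ (ν T : ℝ) (u : ℝ → EuclideanSpace ℝ (Fin 3) → EuclideanSpace ℝ (Fin 3)) (p : ℝ → EuclideanSpace ℝ (Fin 3) → ℝ), 0 < ν → 0 < T → Literature.Analysis.FluidPDE.IsClassicalNSSolutionOn (Set.Ico 0 T) ν 0 u p → Literature.Analysis.FluidPDE.IsLerayHopfOn T ν 0 (u 0) u → ∀ (c t : ℝ), 0 < c → t ∈ Set.Ico 0 T → (∫ τ in Set.Ioo 0 t, ∫ x, Set.indicator {x | c < ‖u τ x‖} (fun x => ‖fderiv ℝ (fun y => ‖u τ y‖) x‖) x) ≤ Real.sqrt ((∫⁻ τ in Set.Ioo 0 T, volume {x | c < ‖u τ x‖}).toReal) * Real.sqrt ((∫⁻ τ in Set.Ioo 0 T, ∫⁻ x, Set.indicator {x | c < ‖u τ x‖} (fun x => ENNReal.ofReal (‖fderiv ℝ (fun y => ‖u τ y‖) x‖ ^ 2)) x).toReal) := by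
  intro ν T u p hν hT hcl hLH c t hc ht
  set Vs : ℝ → ℝ≥0∞ := fun τ => volume {x | c < ‖u τ x‖} with hVs
  set Bs : ℝ → ℝ≥0∞ := fun τ => ∫⁻ x, {x | c < ‖u τ x‖}.indicator
      (fun x => ENNReal.ofReal (‖fderiv ℝ (fun y => ‖u τ y‖) x‖ ^ 2)) x with hBs
  have hVmeas : AEMeasurable Vs (volume.restrict (Ioo 0 t)) :=
    levelSetModeration_aemeasurable_volume_superlevel hcl.smooth_velocity.continuousOn c ht.2.le
  have hBmeas : AEMeasurable Bs (volume.restrict (Ioo 0 t)) :=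
    levelSetModeration_aemeasurable_dissipationSlice hcl.smooth_velocity hc ht.2.le
  have hVfin : ∫⁻ τ in Ioo 0 T, Vs τ ≠ ∞ := levelSetModeration_highSetMeasure_ne_top hν.le hLH hc
  have hBfin : ∫⁻ τ in Ioo 0 T, Bs τ ≠ ∞ := (levelSetDissipation_ne_top hcl hLH hT hν.le hc.le).1
  have hBfin' : ∫⁻ τ in Ioo 0 t, Bs τ ≠ ∞ :=
    ne_top_of_le_ne_top hBfin (lintegral_mono_set (Ioo_subset_Ioo le_rfl ht.2.le))
  have hBae : ∀ᵐ τ ∂(volume.restrict (Ioo 0 t)), Bs τ < ∞ := ae_lt_top' hBmeas hBfin'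
  refine levelSetModeration_setIntegral_le_sqrt_mul_sqrt t T _ Vs Bs ht.2.le hVmeas hBmeas hVfin
    hBfin ?_
  filter_upwards [hBae, ae_restrict_mem measurableSet_Ioo] with τ hBτ hτ
  have hτ' : τ ∈ Ico 0 T := ⟨hτ.1.le, hτ.2.trans ht.2⟩
  have hVτ : Vs τ ≠ ∞ := ne_top_of_le_ne_top
    (ENNReal.div_ne_top ENNReal.ofReal_ne_top ((ENNReal.ofReal_pos.2 (by positivity)).ne'))
    (levelSetModeration_volume_superlevel_le hν.le hLH ⟨hτ'.1, hτ'.2.le⟩ hc)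
  exact levelSetModeration_integral_indicator_norm_fderiv_le (hcl.contDiff_velocity hτ').continuous
    hVτ hBτ.ne

end Summit.NavierStokesRegularity.NavierStokesRegularity.Theorems
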